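import Summits.RiemannHypothesis.RiemannHypothesis.Theorems.WeilFormatCArchSectorEntries
import Literature.NumberTheory.LFunctions.YoshidaWindowGramTailJBox
import Literature.NumberTheory.LFunctions.YoshidaWindowGramFrontDoor
import HarnessLib

/-!
# Format C, design C∞ (E2, data side): the two scalar REMAINDER inputs `Λ-sum` and `ρ(2a)` from certified objects

Route context: Fourier–Galerkin / Schur-complement certificates of Weil positivity on a window ("format C", C∞ door
`weilPositivityOn_of_cinf_pipeline`; supporting stmt-RiemannHypothesis-0098; seat rh-explicit-weil-2, cell memo
`run/shared/lean/pub/rh-explicit/rh-explicit-weil-2/gen17/EMITTER-PHASE2.md` §3 (c)).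

The row/image REMAINDER primitives of the C∞ door (`CinfPrimRT.rhoRowTDataNear_even`, `CinfPrimRO.rhoRowTDataNear_odd`, the
image remainders) take, besides the row inputs, two scalar boxes as hypotheses: `Lam ∋ Σ_{k ∈ weilPrimeIndex a} Λ(k) k^{-1/2}` and
`Rho ∋ weilArchDensity (2a)`.  This file produces them from objects every format-C rung already certifies:

* `CinfRemIn.lamBox` / ★ `mem_lamBox` — the sum of the certified weight list `C.wts` of the constants record (`Encl.ConstsValid`),
  identified with the prime sum by `sum_weilPrimeIndex_eq_listSum` (`PrimeData`);
* ★ `mem_rho_of_moments` — `weilArchDensity (2a)` IS the zeroth node moment `Σ_k e^{−2a l_k}`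
  (`hasSum_exp_neg_two_mul_digammaNode`), so the entry `s = 0` of a certified node-moment list (`CinfRowIn.mem_momList`) encloses it.

Interval plumbing over landed facts; standard axioms; no RH claim.
-/

set_option autoImplicit false
-- `Summit.RiemannHypothesis.RiemannHypothesis.…` is the layout-mandated namespace (summit = problem name).
set_option linter.dupNamespace false

open Finset
open scoped Real ArithmeticFunction.vonMangoldt

namespace Summit.RiemannHypothesis.RiemannHypothesis.Theorems.WeilFormatC

namespace CinfRemIn

open Literature.NumberTheory.LFunctions Literature.NumberTheory.LFunctions.Yoshida1992 Literature.Analysis.SpecialFunctions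
open Literature.Analysis.ValidatedNumerics Literature.Analysis.ValidatedNumerics.NumericsMP
open Encl (Consts ConstsValid)

variable {S : ℕ} {a : ℝ} {ks : List PrimeLen} {C : Consts}

/-- Box of `Σ_{k ∈ weilPrimeIndex a} Λ(k) k^{-1/2}`: the sum of the weight list of the constants record. -/
def lamBox (S : ℕ) (C : Consts) : MI := Encl.sumBox S (fun i ↦ C.wts.getD i default) C.wts.length

/-- ★ `lamBox ∋ Σ_{k ∈ weilPrimeIndex a} Λ(k)/√k`. -/
theorem mem_lamBox (hks : PrimeData a ks) (hC : ConstsValid S a ks C) :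
    MI.mem S (∑ k ∈ weilPrimeIndex a, (Λ k : ℝ) / Real.sqrt k) (lamBox S C) := by
  have h1 : ∑ k ∈ weilPrimeIndex a, (Λ k : ℝ) / Real.sqrt k
      = ∑ i ∈ Finset.range ks.length, (ks.getD i default).wt := by
    have h := Encl.sum_weilPrimeIndex_eq_listSum hks (fun _ ↦ (1 : ℝ))
    simp only [mul_one] at h
    rw [h, Encl.list_sum_map_eq_sum_range]
  rw [h1, lamBox, hC.wts_len]
  exact Encl.mem_sumBox S ks.length fun i hi ↦ hC.wts i hi

/-- ★ `ρ(2a) = weilArchDensity (2a)` is enclosed by the zeroth entry of a certified node-moment list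
(`hD` as produced by `CinfRowIn.mem_momList`; any order bound `N`). -/
theorem mem_rho_of_moments (ha : 0 < a) {N : ℕ} {Dl : List MI}
    (hD : ∀ s, s ≤ N → MI.mem S (∑' k : ℕ, Real.exp (-(2 * a * digammaNode k)) * digammaNode k ^ s) (Dl.getD s default)) :
    MI.mem S (weilArchDensity (2 * a)) (Dl.getD 0 default) := by
  have h0 := hD 0 (Nat.zero_le N)
  simp only [pow_zero, mul_one] at h0
  rwa [(hasSum_exp_neg_two_mul_digammaNode ha).tsum_eq] at h0

end CinfRemIn

end Summit.RiemannHypothesis.RiemannHypothesis.Theorems.WeilFormatC
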